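import Literature.NumberTheory.LFunctions.LagariasDifferencedXiProofs
import Literature.NumberTheory.LFunctions.ZetaArgVariation
import Literature.Analysis.SpecialFunctions.DigammaLogBound
import HarnessLib

/-!
# Proof of Lagarias 2005, Theorem 3.1: the zero counts `N(T, A_{h,θ})`, `N(T, B_{h,θ})`

LINE 1 — LABEL: RH-FREE (Theorem 3.1 (1)); Theorem 3.1 (2) is an RH-CONSEQUENCE whose RH binder is a hypothesis of
the discharged statement, never dropped and never asserted. bears_on: LADDER-RH B-C/B-P (COLUMN 6, de Branges).
WHAT THIS IS NOT: a zero count for the auxiliary entire functions `A_{h,θ}`, `B_{h,θ}` of a printed paper — a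
discharge of two named facts of the corpus, not a route and not progress toward RH; nothing here bears on the truth
of RH.

Discharges (cell rh-crit/dbl, corpus C2, source S5, nodes La05:T3.1(1), La05:T3.1(2); statements typed in
`LagariasDifferencedXi.lean`, objects in `LagariasDifferencedXiDefs.lean`):

* `Literature.NumberTheory.LFunctions.lagarias2005_thm_3_1_1_holds : lagarias2005_thm_3_1_1` — J. C. Lagarias,
  *Zero spacing distributions for differenced L-functions*, Acta Arith. 120 (2005) 159–184 = arXiv:math/0601653,
  **Theorem 3.1 (1)** (arXiv p. 9; held text p0007 L10): for `|h| ≥ ½` there is `C = C(h)` with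
  `|N(T, A_{h,θ}) − ((1/π) T log T − (1/π)(log 2π + 1) T)| ≤ C log T` for all `0 ≤ θ < 2π`, `T ≥ 2`, and the same
  for `B_{h,θ}` (`N(T, F)` = `stripZeroCount F T`, main term `lagariasZeroCountMain`);
* `Literature.NumberTheory.LFunctions.lagarias2005_thm_3_1_2_holds : lagarias2005_thm_3_1_2` — **Theorem 3.1 (2)**:
  under RH the same for every `h ≠ 0`.

## The printed proof and how it is followed

Lagarias (p. 9): choose the branch `φ_h(t) = arg ξ(½ + h + it)` continuous on the zero-free line (`φ_h(0) = 0`);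
by Lemma 2.2 / Theorem 2.1 the zeros of `A_{h,θ}`, `B_{h,θ}` are on the critical line and simple, and they are
exactly the solutions of `φ_h(γ) ≡ π/2 + θ`, resp. `≡ θ (mod π)`; `φ_h` is strictly increasing, so
`|N_h(T) − (φ_h(T) − φ_h(−T))/π| ≤ 2`; `φ_h` is odd; and by `ξ = ½ s(s−1) π^{−s/2} Γ(s/2) ζ(s)`,
Stirling's formula (3.3)–(3.4) and the standard estimate `arg ζ(½ + h + it) = O(log |t|)` on a zero-free
half-plane, `φ_h(T) = (T/2) log(T/2π) − T/2 + O(log T)` (3.5).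

This file follows that architecture literally, in four sections:

* **A. Continuous phase.** For a nowhere-vanishing `C¹` path `W`, `W(t) = W(0) exp(∫₀ᵗ W′/W)` (ODE uniqueness,
  `eq_mul_exp_integral_of_hasDerivAt`), hence `Re W = ‖W‖ cos Φ`, `Im W = ‖W‖ sin Φ` with the CONTINUOUS phase
  `Φ(t) = arg W(0) + Im ∫₀ᵗ W′/W`; for `W(t) = e^{iθ} ξ(½ + h + it)` this `Φ` is `θ + arg ξ(½+h) + φ_h(t)` with
  `φ_h(t) = ∫₀ᵗ Re ξ′/ξ(½ + h + iu) du` — the tree's model of a continuous argument (cf. `riemannSiegelTheta`).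
* **B. Counting.** Along a continuous strictly increasing phase the zeros of `sin Ψ` on `[t₁, t₂]` correspond
  bijectively (intermediate value theorem + injectivity) to the multiples of `π` in `[Ψ(t₁), Ψ(t₂)]`, whose number
  is within `1` of `(Ψ(t₂) − Ψ(t₁))/π` (`finite_and_abs_ncard_sin_zero_sub_le`); and for an entire `F` with all
  zeros on the line and simple (Theorem 2.1, `diffXi_zeroPattern_of_logDeriv_pos`), `N(T, F)` is the number of zero
  ordinates in `[−T, T]` (`stripZeroCount_eq_ncard`).
* **C. Asymptotics of `φ_h`.** On `2 ≤ u ≤ T`, `ξ′/ξ = 1/s + 1/(s−1) + Γℝ′/Γℝ + ζ′/ζ`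
  (`logDeriv_riemannXi_eq_add_logDeriv_riemannZeta`): the elementary factors change the argument by `O(1)` (C1);
  the `Γ`-factor is moved by Cauchy–Goursat on `[½, ½+h] × [2, T]` to the critical line, where its phase is the
  tree's `θ` BY DEFINITION, with `|θ′(u) − ½ log(u/2π)| ≤ 2/u` (`abs_riemannSiegelThetaDeriv_sub_log_le`) in place
  of Stirling's formula for `log Γ` and `‖ψ(w)‖ ≤ log(1 + ‖w‖) + 8` (`norm_digamma_le_log`) on the horizontal sides
  (C2) — the one deviation from print, same analytic content; the `ζ`-factor is moved by Cauchy–Goursat on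
  `[½+h, 2] × [2, T]` to `Re s = 2` (`Re ζ > 0`, change of argument `≤ π`) at the cost of Backlund's Jensen bound
  `|Im ∫ ζ′/ζ| ≤ π (log(120(T+4))/log(7/6) + 1)` on the top side
  (`Literature.Analysis.Complex.abs_im_integral_logDeriv_le_backlund`, the tree's proof of `S(T) = O(log T)`), or,
  for `½ + h > 2`, read off directly from `Re ζ > 0` (C3). Result: `|φ_h(T) − ((T/2) log(T/2π) − T/2)| ≤ C log T`
  (`exists_abs_xiPhase_sub_main_le`).
* **D. Assembly** (`stripZeroCount_diffXi_estimate`): the hypotheses are (2.6) for `E_{h,θ}`, the phase velocity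
  `Re ξ′/ξ(½ + h + it) > 0` and a zero-free closed half-plane `Re s ≥ ½ + h`; for Theorem 3.1 (1) (`|h| ≥ ½`) these
  are `diffXiErot_critHB`, `Lagarias1999Eq14.re_logDeriv_riemannXi_pos_of_one_le_re` and
  `riemannZeta_ne_zero_of_one_le_re`; for (2) (RH, `h ≠ 0`) `diffXiErot_critHB_rh`,
  `Lagarias1999_riemannHypothesis_iff_holds`, `riemannZeta_ne_zero_of_riemannHypothesis`; `h < 0` is reduced to
  `h > 0` by `A_{−h,θ} = A_{h,−θ}`, `B_{−h,θ} = −B_{h,−θ}` (`diffXiArot_neg`, `diffXiBrot_neg`, `stripZeroCount_neg`),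
  and the estimate holds for every real `θ` (the printed range `0 ≤ θ < 2π` is not used). As typed, the constant
  depends on `h` and is uniform in `θ` (see the docstring of `lagarias2005_thm_3_1_1` on the printed "independent of
  `h`").

Everything is PROVED; no definition and no named fact is introduced (net debt −2). Helper lemmas live in the
sub-namespace `Literature.NumberTheory.LFunctions.Lagarias2005Counting`.

## References

* [Lagarias2005] J. C. Lagarias, *Zero spacing distributions for differenced L-functions*, Acta Arith. 120 (2005),
  no. 2, 159–184, doi:10.4064/aa120-2-4 = arXiv:math/0601653 — Theorem 3.1 and its proof, (3.2)–(3.5).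
* [Titchmarsh1986] E. C. Titchmarsh, *The Theory of the Riemann Zeta-Function*, 2nd ed. (rev. D. R. Heath-Brown),
  OUP 1986, §9.2–9.4 (Backlund's `S(T) = O(log T)`; tree: `ZetaArgVariation.lean`, `BacklundArgVariation.lean`).
-/

noncomputable section

open Complex Set MeasureTheory Filter Topology intervalIntegral Metric
open scoped Real ComplexConjugate Interval

namespace Literature.NumberTheory.LFunctions

namespace Lagarias2005Counting

/-! ## A. Polar form of a non-vanishing `C¹` path and the continuous phase -/

/-- ODE uniqueness: a nowhere-vanishing `C¹` path `W : ℝ → ℂ` is `W(0) · exp(∫₀ᵗ W′/W)`. [folklore] -/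
private theorem eq_mul_exp_integral_of_hasDerivAt {W W' : ℝ → ℂ} (hW : ∀ t, HasDerivAt W (W' t) t)
    (hW' : Continuous W') (h0 : ∀ t, W t ≠ 0) (t : ℝ) :
    W t = W 0 * Complex.exp (∫ u in (0:ℝ)..t, W' u / W u) := by
  have hWc : Continuous W := continuous_iff_continuousAt.2 fun t ↦ (hW t).continuousAt
  have hq : Continuous fun u ↦ W' u / W u := hW'.div hWc h0
  have hL : ∀ t, HasDerivAt (fun t ↦ ∫ u in (0:ℝ)..t, W' u / W u) (W' t / W t) t := fun t ↦
    (hq.integral_hasStrictDerivAt 0 t).hasDerivAt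
  have hQ : ∀ t, HasDerivAt (fun t ↦ W t * Complex.exp (-(∫ u in (0:ℝ)..t, W' u / W u))) 0 t := by
    intro t
    have h1 : HasDerivAt (fun s ↦ Complex.exp (-(∫ u in (0:ℝ)..s, W' u / W u)))
        (Complex.exp (-(∫ u in (0:ℝ)..t, W' u / W u)) * -(W' t / W t)) t := ((hL t).neg).cexp
    have h2 : HasDerivAt (fun s ↦ W s * Complex.exp (-(∫ u in (0:ℝ)..s, W' u / W u)))
        (W' t * Complex.exp (-(∫ u in (0:ℝ)..t, W' u / W u)) +
          W t * (Complex.exp (-(∫ u in (0:ℝ)..t, W' u / W u)) * -(W' t / W t))) t := (hW t).mul h1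
    have ht0 := h0 t
    have e : W' t * Complex.exp (-(∫ u in (0:ℝ)..t, W' u / W u)) +
        W t * (Complex.exp (-(∫ u in (0:ℝ)..t, W' u / W u)) * -(W' t / W t)) = 0 := by
      field_simp
      ring
    rwa [e] at h2
  have hconst : ∀ t, W t * Complex.exp (-(∫ u in (0:ℝ)..t, W' u / W u)) = W 0 := by
    intro t
    have hd : Differentiable ℝ (fun t ↦ W t * Complex.exp (-(∫ u in (0:ℝ)..t, W' u / W u))) :=
      fun t ↦ (hQ t).differentiableAt
    have := is_const_of_deriv_eq_zero hd (fun t ↦ (hQ t).deriv) t 0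
    simpa using this
  have h := hconst t
  calc W t = W t * Complex.exp (-(∫ u in (0:ℝ)..t, W' u / W u)) *
      Complex.exp (∫ u in (0:ℝ)..t, W' u / W u) := by
        rw [mul_assoc, ← Complex.exp_add, neg_add_cancel, Complex.exp_zero, mul_one]
    _ = W 0 * Complex.exp (∫ u in (0:ℝ)..t, W' u / W u) := by rw [h]

/-- Polar decomposition of a nowhere-vanishing `C¹` path: with `Φ(t) = arg W(0) + Im ∫₀ᵗ W′/W`,
`Re W(t) = ‖W(t)‖ cos Φ(t)` and `Im W(t) = ‖W(t)‖ sin Φ(t)`. [folklore] -/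
private theorem re_im_eq_norm_mul_of_hasDerivAt {W W' : ℝ → ℂ} (hW : ∀ t, HasDerivAt W (W' t) t)
    (hW' : Continuous W') (h0 : ∀ t, W t ≠ 0) (t : ℝ) :
    (W t).re = ‖W t‖ * Real.cos (arg (W 0) + (∫ u in (0:ℝ)..t, W' u / W u).im) ∧
      (W t).im = ‖W t‖ * Real.sin (arg (W 0) + (∫ u in (0:ℝ)..t, W' u / W u).im) := by
  set L : ℂ := ∫ u in (0:ℝ)..t, W' u / W u with hL
  have hpol : W 0 = ‖W 0‖ * Complex.exp (arg (W 0) * I) := (Complex.norm_mul_exp_arg_mul_I (W 0)).symm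
  have key : W t = ‖W 0‖ * Complex.exp (arg (W 0) * I + L) := by
    rw [eq_mul_exp_integral_of_hasDerivAt hW hW' h0 t, ← hL, Complex.exp_add, ← mul_assoc, ← hpol]
  have hnorm : ‖W t‖ = ‖W 0‖ * Real.exp L.re := by
    rw [key, norm_mul, Complex.norm_real, Real.norm_eq_abs, abs_norm, Complex.norm_exp]
    simp
  have hre : (arg (W 0) * I + L).re = L.re := by simp
  have him : (arg (W 0) * I + L).im = arg (W 0) + L.im := by simp
  constructor
  · rw [hnorm]
    conv_lhs => rw [key]
    rw [Complex.re_ofReal_mul, Complex.exp_re, hre, him]; ring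
  · rw [hnorm]
    conv_lhs => rw [key]
    rw [Complex.im_ofReal_mul, Complex.exp_im, hre, him]; ring

/-- Zero criteria in polar form: `Re W(t) = 0 ⟺ cos Φ(t) = 0` and `Im W(t) = 0 ⟺ sin Φ(t) = 0`. [folklore] -/
private theorem re_eq_zero_iff_cos_of_hasDerivAt {W W' : ℝ → ℂ} (hW : ∀ t, HasDerivAt W (W' t) t)
    (hW' : Continuous W') (h0 : ∀ t, W t ≠ 0) (t : ℝ) :
    ((W t).re = 0 ↔ Real.cos (arg (W 0) + (∫ u in (0:ℝ)..t, W' u / W u).im) = 0) ∧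
      ((W t).im = 0 ↔ Real.sin (arg (W 0) + (∫ u in (0:ℝ)..t, W' u / W u).im) = 0) := by
  obtain ⟨h1, h2⟩ := re_im_eq_norm_mul_of_hasDerivAt hW hW' h0 t
  have hn : ‖W t‖ ≠ 0 := norm_ne_zero_iff.2 (h0 t)
  constructor
  · rw [h1]; exact ⟨fun h ↦ (mul_eq_zero.1 h).resolve_left hn, fun h ↦ by rw [h, mul_zero]⟩
  · rw [h2]; exact ⟨fun h ↦ (mul_eq_zero.1 h).resolve_left hn, fun h ↦ by rw [h, mul_zero]⟩

/-! ## B. Counting lattice points and sine zeros along a monotone phase -/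

/-- The integers `k` with `a ≤ kπ ≤ b` are those in `[⌈a/π⌉, ⌊b/π⌋]`. [folklore] -/
private theorem setOf_int_mul_pi_mem_eq (a b : ℝ) :
    {k : ℤ | a ≤ (k : ℝ) * π ∧ (k : ℝ) * π ≤ b} = ↑(Finset.Icc ⌈a / π⌉ ⌊b / π⌋) := by
  ext k
  simp only [mem_setOf_eq, Finset.coe_Icc, mem_Icc, Int.ceil_le, Int.le_floor]
  rw [div_le_iff₀ Real.pi_pos, le_div_iff₀ Real.pi_pos]

/-- **Lattice-point count.** For `a ≤ b` the number `n` of integers `k` with `a ≤ kπ ≤ b` satisfies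
`|n − (b − a)/π| ≤ 1`. [folklore] -/
private theorem abs_ncard_int_mul_pi_mem_sub_le {a b : ℝ} (hab : a ≤ b) :
    |(({k : ℤ | a ≤ (k : ℝ) * π ∧ (k : ℝ) * π ≤ b}.ncard : ℕ) : ℝ) - (b - a) / π| ≤ 1 := by
  rw [setOf_int_mul_pi_mem_eq, Set.ncard_coe_finset, Int.card_Icc]
  have hπ := Real.pi_pos
  have hab' : a / π ≤ b / π := div_le_div_of_nonneg_right hab hπ.le
  have e : (b - a) / π = b / π - a / π := by ring
  rw [e]
  set a' := a / π
  set b' := b / π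
  have h1 : (⌈a'⌉ : ℝ) < a' + 1 := Int.ceil_lt_add_one a'
  have h2 : a' ≤ (⌈a'⌉ : ℝ) := Int.le_ceil a'
  have h3 : (⌊b'⌋ : ℝ) ≤ b' := Int.floor_le b'
  have h4 : b' < (⌊b'⌋ : ℝ) + 1 := Int.lt_floor_add_one b'
  rcases le_or_gt ⌈a'⌉ ⌊b'⌋ with hle | hgt
  · have hnn : 0 ≤ ⌊b'⌋ + 1 - ⌈a'⌉ := by omega
    rw [show (((⌊b'⌋ + 1 - ⌈a'⌉).toNat : ℕ) : ℝ) = ((⌊b'⌋ + 1 - ⌈a'⌉ : ℤ) : ℝ) by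
      exact_mod_cast Int.toNat_of_nonneg hnn]
    push_cast
    rw [abs_le]
    constructor <;> linarith
  · have hz : (⌊b'⌋ + 1 - ⌈a'⌉).toNat = 0 := by
      rw [Int.toNat_eq_zero]; omega
    rw [hz]
    have hgt' : (⌊b'⌋ : ℝ) + 1 ≤ ⌈a'⌉ := by exact_mod_cast hgt
    rw [abs_le]
    push_cast
    constructor <;> linarith

/-- **Counting sine zeros along a strictly increasing continuous phase.** If `Ψ` is continuous and
strictly increasing on `[t₁, t₂]`, the set of `t ∈ [t₁, t₂]` with `sin Ψ(t) = 0` is finite and its size `n`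
satisfies `|n − (Ψ(t₂) − Ψ(t₁))/π| ≤ 1` (the zeros correspond bijectively to the multiples of `π` in
`[Ψ(t₁), Ψ(t₂)]`). [folklore] -/
private theorem finite_and_abs_ncard_sin_zero_sub_le {Ψ : ℝ → ℝ} {t₁ t₂ : ℝ} (h12 : t₁ ≤ t₂)
    (hc : ContinuousOn Ψ (Icc t₁ t₂)) (hm : StrictMonoOn Ψ (Icc t₁ t₂)) :
    {t : ℝ | t ∈ Icc t₁ t₂ ∧ Real.sin (Ψ t) = 0}.Finite ∧
      |(({t : ℝ | t ∈ Icc t₁ t₂ ∧ Real.sin (Ψ t) = 0}.ncard : ℕ) : ℝ) - (Ψ t₂ - Ψ t₁) / π| ≤ 1 := by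
  set S := {t : ℝ | t ∈ Icc t₁ t₂ ∧ Real.sin (Ψ t) = 0} with hS
  set K := {k : ℤ | Ψ t₁ ≤ (k : ℝ) * π ∧ (k : ℝ) * π ≤ Ψ t₂} with hK
  set Z := {y : ℝ | y ∈ Icc (Ψ t₁) (Ψ t₂) ∧ Real.sin y = 0} with hZ
  have hinj : InjOn Ψ S := hm.injOn.mono fun t ht ↦ ht.1
  -- `Ψ '' S = Z`
  have himage : Ψ '' S = Z := by
    apply Subset.antisymm
    · rintro _ ⟨t, ⟨ht, hsin⟩, rfl⟩
      exact ⟨⟨hm.monotoneOn (left_mem_Icc.2 h12) ht ht.1, hm.monotoneOn ht (right_mem_Icc.2 h12) ht.2⟩, hsin⟩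
    · rintro y ⟨hy, hsin⟩
      obtain ⟨t, ht, rfl⟩ := intermediate_value_Icc h12 hc hy
      exact ⟨t, ⟨ht, hsin⟩, rfl⟩
  -- `Z` is the image of `K` under `k ↦ kπ`
  have hZK : Z = (fun k : ℤ ↦ (k : ℝ) * π) '' K := by
    ext y
    constructor
    · rintro ⟨hy, hsin⟩
      obtain ⟨k, hk⟩ := Real.sin_eq_zero_iff.1 hsin
      refine ⟨k, ⟨?_, ?_⟩, hk⟩ <;> rw [hk] <;> [exact hy.1; exact hy.2]
    · rintro ⟨k, ⟨hk1, hk2⟩, rfl⟩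
      exact ⟨⟨hk1, hk2⟩, Real.sin_eq_zero_iff.2 ⟨k, rfl⟩⟩
  have hKfin : K.Finite := by
    rw [hK, setOf_int_mul_pi_mem_eq]; exact Finset.finite_toSet _
  have hmul_inj : Function.Injective (fun k : ℤ ↦ (k : ℝ) * π) := fun k₁ k₂ h ↦ by
    have := mul_right_cancel₀ Real.pi_pos.ne' h
    exact_mod_cast this
  have hZfin : Z.Finite := by rw [hZK]; exact hKfin.image _
  have hSfin : S.Finite := Set.Finite.of_finite_image (by rw [himage]; exact hZfin) hinj
  refine ⟨hSfin, ?_⟩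
  have hcard : S.ncard = K.ncard := by
    rw [← hinj.ncard_image, himage, hZK, Set.ncard_image_of_injective _ hmul_inj]
  rw [hcard]
  exact abs_ncard_int_mul_pi_mem_sub_le (hm.monotoneOn (left_mem_Icc.2 h12) (right_mem_Icc.2 h12) h12)

/-! ## B'. `N(T, F)` for an entire `F` with simple critical zeros -/

/-- For an entire `F` whose zeros all lie on `Re s = ½` and are simple, `N(T, F)` (`stripZeroCount`) is the
number of zero ordinates `t` with `|t| ≤ T`, when these are finite in number ("Because all zeros are on the
critical line … to estimate `N_h(T)` it suffices to bound the change in argument").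
[cite: Lagarias2005, §3 p. 9 (definition of N(T, F)) and proof of Theorem 3.1 (held text p0007 L7–8, L76–79)] -/
theorem stripZeroCount_eq_ncard {F : ℂ → ℂ} (hF : Differentiable ℂ F) (hline : AllZerosOnCriticalLine F)
    (hsimple : AllZerosSimple F) {T : ℝ} (hfin : {t : ℝ | F (1 / 2 + t * I) = 0 ∧ |t| ≤ T}.Finite) :
    stripZeroCount F T = {t : ℝ | F (1 / 2 + t * I) = 0 ∧ |t| ≤ T}.ncard := by
  set S := {t : ℝ | F (1 / 2 + t * I) = 0 ∧ |t| ≤ T} with hS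
  have hinj : Function.Injective (fun t : ℝ ↦ (1 / 2 : ℂ) + t * I) := by
    intro t₁ t₂ h
    have := congrArg Complex.im h
    simpa using this
  have hset : {s : ℂ | F s = 0 ∧ |s.im| ≤ T} = (fun t : ℝ ↦ (1 / 2 : ℂ) + t * I) '' S := by
    ext s
    constructor
    · rintro ⟨h0, hT⟩
      have hre := hline s h0
      have hs : s = 1 / 2 + (s.im : ℝ) * I := by
        apply Complex.ext <;> simp [hre]
      exact ⟨s.im, ⟨by rw [← hs]; exact h0, hT⟩, hs.symm⟩
    · rintro ⟨t, ⟨h0, hT⟩, rfl⟩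
      exact ⟨h0, by simpa using hT⟩
  unfold stripZeroCount
  rw [hset, finsum_mem_image hinj.injOn]
  have h1 : ∀ t ∈ S, analyticOrderNatAt F (1 / 2 + t * I) = 1 := by
    intro t ht
    have h := (hF.analyticAt _).analyticOrderAt_eq_one_of_zero_deriv_ne_zero ht.1 (hsimple _ ht.1)
    rw [analyticOrderNatAt, h]
    rfl
  rw [finsum_mem_congr rfl h1, finsum_mem_eq_finite_toFinset_sum _ hfin, Finset.sum_const, smul_eq_mul, mul_one,
    Set.ncard_eq_toFinset_card S hfin]

/-- `N(T, −F) = N(T, F)` (used for `B_{−h,θ} = −B_{h,−θ}`). [cite: Lagarias2005, §3 p. 9 (definition of N(T, F); held text p0007 L7–8)] -/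
theorem stripZeroCount_neg (F : ℂ → ℂ) (T : ℝ) : stripZeroCount (-F) T = stripZeroCount F T := by
  unfold stripZeroCount
  have h1 : {s : ℂ | (-F) s = 0 ∧ |s.im| ≤ T} = {s : ℂ | F s = 0 ∧ |s.im| ≤ T} := by
    ext s; simp
  rw [h1]
  refine finsum_mem_congr rfl fun s _ ↦ ?_
  rw [analyticOrderNatAt, analyticOrderNatAt, analyticOrderAt_neg]


/-! ## C. The phase of `ξ` along a zero-free vertical line `Re s = x`: estimates for `T ≥ 2` -/

/-- Imaginary part of an interval integral (integrable version). [folklore] -/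
private theorem im_intervalIntegral_eq {q : ℝ → ℂ} {a b : ℝ} (hq : IntervalIntegrable q volume a b) :
    (∫ u in a..b, q u).im = ∫ u in a..b, (q u).im := by
  have hcomm := ContinuousLinearMap.intervalIntegral_comp_comm (𝕜 := ℝ) imCLM hq
  simpa only [imCLM_apply] using hcomm.symm

/-- Real part of an interval integral (integrable version). [folklore] -/
private theorem re_intervalIntegral_eq {q : ℝ → ℂ} {a b : ℝ} (hq : IntervalIntegrable q volume a b) :
    (∫ u in a..b, q u).re = ∫ u in a..b, (q u).re := by
  have hcomm := ContinuousLinearMap.intervalIntegral_comp_comm (𝕜 := ℝ) reCLM hq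
  simpa only [reCLM_apply] using hcomm.symm

/-- Absorbing constants: for `T ≥ 2`, `A + B log T ≤ (A / log 2 + B) log T` when `A ≥ 0`. [folklore] -/
private theorem const_add_mul_log_le {A B T : ℝ} (hA : 0 ≤ A) (hT : 2 ≤ T) :
    A + B * Real.log T ≤ (A / Real.log 2 + B) * Real.log T := by
  have hlog2 : 0 < Real.log 2 := Real.log_pos (by norm_num)
  have hlogT : Real.log 2 ≤ Real.log T := Real.log_le_log (by norm_num) hT
  have h1 : A ≤ A / Real.log 2 * Real.log T := by
    rw [div_mul_eq_mul_div, le_div_iff₀ hlog2]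
    exact mul_le_mul_of_nonneg_left hlogT hA
  nlinarith

/-! ### C1. The elementary factors `1/s`, `1/(s − 1)` -/

/-- Along `Re s = x`, `2 ≤ Im s ≤ T`, the factor `1/(s − ρ)` (`ρ` real) changes the argument by at most
`2π`: `|∫₂ᵀ Re (x + iu − ρ)⁻¹ du| ≤ 2π` (printed: "`arg(s(s−1)) = π + O(1/(|t|+1))`", (3.5)).
[cite: Lagarias2005, proof of Theorem 3.1, (3.5) (arXiv p. 9; held text p0007 L108–110)] -/
theorem abs_integral_re_inv_sub_vertical_le (x ρ : ℝ) {T : ℝ} (hT : 2 ≤ T) :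
    |∫ u in (2:ℝ)..T, (((x : ℂ) + u * I - ρ)⁻¹).re| ≤ 2 * π := by
  have hne : ∀ u ∈ Icc (2:ℝ) T, (x : ℂ) + u * I - ρ ≠ 0 := fun u hu h0 ↦ by
    have := congrArg Complex.im h0
    simp at this
    linarith [hu.1]
  have hg : ∀ y ∈ Icc (2:ℝ) T, AnalyticAt ℂ (fun s : ℂ ↦ s - ρ) (x + y * I) := fun _ _ ↦
    analyticAt_id.sub analyticAt_const
  have hs : ∀ y ∈ Icc (2:ℝ) T, (fun s : ℂ ↦ s - ρ) (x + y * I) ∈ slitPlane := fun y hy ↦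
    Or.inr (by simp; linarith [hy.1])
  have h := Literature.Analysis.Complex.integral_logDeriv_vertical x hT hg hs
  have hderiv : ∀ z : ℂ, deriv (fun s : ℂ ↦ s - ρ) z = 1 := fun z ↦ by
    rw [deriv_sub_const, deriv_id'']
  simp only [hderiv, one_div] at h
  have hint : IntervalIntegrable (fun u : ℝ ↦ ((x : ℂ) + u * I - ρ)⁻¹) volume 2 T :=
    Literature.Analysis.Complex.intervalIntegrable_of_continuousAt_vertical (F := fun s ↦ (s - ρ)⁻¹) x hT
      fun u hu ↦ (continuousAt_id.sub continuousAt_const).inv₀ (hne u hu)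
  have hre : (∫ u in (2:ℝ)..T, (((x : ℂ) + u * I - ρ)⁻¹).re) =
      (I * ∫ u in (2:ℝ)..T, ((x : ℂ) + u * I - ρ)⁻¹).im := by
    rw [← re_intervalIntegral_eq hint, mul_im, I_re, I_im]; ring
  rw [hre, h, sub_im, log_im, log_im]
  have a1 := Complex.abs_arg_le_pi ((x : ℂ) + T * I - ρ)
  have a2 := Complex.abs_arg_le_pi ((x : ℂ) + (2:ℝ) * I - ρ)
  have := abs_sub (arg ((x : ℂ) + T * I - ρ)) (arg ((x : ℂ) + (2:ℝ) * I - ρ))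
  linarith

/-! ### C2. The `Γℝ` factor: Cauchy–Goursat to the critical line, where its phase is `θ` -/

/-- A logarithmic bound for `Γℝ'/Γℝ` on vertical strips: `‖Γℝ'/Γℝ(t + iy)‖ ≤ ½ log π + 4 + ½ log(t + y)` for
`t > 0`, `y ≥ 2` (from `‖ψ(w)‖ ≤ log(1 + ‖w‖) + 8`). [folklore] -/
private theorem norm_logDeriv_Gammaℝ_le_log {t y : ℝ} (ht : 0 < t) (hy : 2 ≤ y) :
    ‖logDeriv Gammaℝ ((t : ℂ) + y * I)‖ ≤ Real.log π / 2 + 4 + Real.log (t + y) / 2 := by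
  have hre : 0 < ((t : ℂ) + y * I).re := by simp [ht]
  rw [Literature.NumberTheory.LFunctions.logDeriv_Gammaℝ (half_ne_neg_nat_of_re_pos' hre),
    ← Complex.ofReal_log Real.pi_pos.le]
  set w : ℂ := ((t : ℂ) + y * I) / 2 with hw
  have hwre : 0 < w.re := by simp [hw, ht]
  have hwim : w.im = y / 2 := by simp [hw]
  have hwim' : 1 / 2 ≤ |w.im| := by rw [hwim, abs_of_nonneg (by linarith)]; linarith
  have hψ := Literature.Analysis.SpecialFunctions.Complex.norm_digamma_le_log hwre hwim'
  have hwnorm : ‖w‖ ≤ (t + y) / 2 := by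
    rw [hw, norm_div, Complex.norm_ofNat]
    have : ‖(t : ℂ) + y * I‖ ≤ t + y := by
      refine (norm_add_le _ _).trans ?_
      rw [Complex.norm_real, norm_mul, Complex.norm_I, mul_one, Complex.norm_real, Real.norm_eq_abs,
        Real.norm_eq_abs, abs_of_pos ht, abs_of_nonneg (by linarith)]
    linarith
  have hlog : Real.log (1 + ‖w‖) ≤ Real.log (t + y) := by
    apply Real.log_le_log (by positivity)
    linarith
  have hlogπ : 0 ≤ Real.log π := Real.log_nonneg (by linarith [Real.pi_gt_three])
  calc ‖-(Real.log π : ℂ) / 2 + digamma w / 2‖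
      ≤ ‖-(Real.log π : ℂ) / 2‖ + ‖digamma w / 2‖ := norm_add_le _ _
    _ = Real.log π / 2 + ‖digamma w‖ / 2 := by
        rw [norm_div, norm_neg, Complex.norm_real, Real.norm_eq_abs, abs_of_nonneg hlogπ, norm_div,
          Complex.norm_ofNat]
    _ ≤ Real.log π / 2 + 4 + Real.log (t + y) / 2 := by linarith

/-- **The `Γℝ` factor along `Re s = x`.** For `x ≥ ½`, `T ≥ 2`: by Cauchy–Goursat on `[½, x] × [2, T]`
for the holomorphic `Γℝ'/Γℝ` (`Re s > 0`),
`∫₂ᵀ Re Γℝ'/Γℝ(x+iu) du = (θ(T) − θ(2)) + Im ∫_{1/2}^{x} Γℝ'/Γℝ(t+iT) dt − Im ∫_{1/2}^{x} Γℝ'/Γℝ(t+2i) dt`,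
the phase of `Γℝ` on the critical line being the tree's `θ` by definition (printed: the argument `φ̃_h` of the
`Γ`-factor `G_h(t)`, (3.3)–(3.4), via Stirling). [cite: Lagarias2005, proof of Theorem 3.1, (3.3)–(3.4) (arXiv p. 9; held text p0007 L87–105)] -/
theorem integral_re_logDeriv_Gammaℝ_vertical_eq {x T : ℝ} (hx : 1 / 2 ≤ x) (hT : 2 ≤ T) :
    ∫ u in (2:ℝ)..T, (logDeriv Gammaℝ ((x : ℂ) + u * I)).re =
      (riemannSiegelTheta T - riemannSiegelTheta 2) +
        (∫ t in (1 / 2 : ℝ)..x, logDeriv Gammaℝ ((t : ℂ) + T * I)).im -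
        (∫ t in (1 / 2 : ℝ)..x, logDeriv Gammaℝ ((t : ℂ) + 2 * I)).im := by
  set G := logDeriv Gammaℝ with hG
  have han : ∀ z : ℂ, 0 < z.re → AnalyticAt ℂ G z := fun z hz ↦ analyticAt_logDeriv_Gammaℝ hz
  have hCG := Literature.Analysis.Complex.rectBoundaryIntegral_eq_zero_of_differentiableOn (F := G)
    (a := 1 / 2) (b := x) (c := 2) (d := T) hx hT (fun z hz ↦ by
      refine (han z ?_).differentiableAt.differentiableWithinAt
      have := (mem_reProdIm.1 hz).1.1
      linarith)
  rw [Literature.Analysis.Complex.rectBoundaryIntegral_def] at hCG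
  simp only [ofReal_ofNat] at hCG
  have hθint : ∀ a b : ℝ, IntervalIntegrable riemannSiegelThetaDeriv volume a b := fun a b ↦
    continuous_riemannSiegelThetaDeriv_holds.intervalIntegrable a b
  have hintv : ∀ x' : ℝ, 0 < x' → IntervalIntegrable (fun y : ℝ ↦ G ((x' : ℂ) + y * I)) volume 2 T :=
    fun x' hx' ↦ Literature.Analysis.Complex.intervalIntegrable_of_continuousAt_vertical (F := G) x' hT
      fun y _ ↦ (han _ (by simp [hx'])).continuousAt
  have hright : (I * ∫ y in (2:ℝ)..T, G ((x : ℂ) + y * I)).im = ∫ u in (2:ℝ)..T, (G ((x : ℂ) + u * I)).re := by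
    rw [mul_im, I_re, I_im, zero_mul, one_mul, zero_add, re_intervalIntegral_eq (hintv x (by linarith))]
  have hleft : (I * ∫ y in (2:ℝ)..T, G (((1 / 2 : ℝ) : ℂ) + y * I)).im =
      riemannSiegelTheta T - riemannSiegelTheta 2 := by
    rw [mul_im, I_re, I_im, zero_mul, one_mul, zero_add, re_intervalIntegral_eq (hintv (1 / 2) (by norm_num)),
      intervalIntegral.integral_congr (fun y _ ↦ logDeriv_Gammaℝ_half_add_re y)]
    simp only [riemannSiegelTheta]
    rw [intervalIntegral.integral_interval_sub_left (hθint 0 T) (hθint 0 2)]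
  have him := congrArg Complex.im hCG
  simp only [sub_im, add_im, zero_im] at him
  rw [hright, hleft] at him
  linarith

/-- `θ(T) − θ(2) = (T/2) log(T/2π) − T/2 + (1 + log π) + O(log T)`, explicitly
`|θ(T) − θ(2) − ((T/2) log(T/2π) − T/2 + 1 + log π)| ≤ 2 log T` for `T ≥ 2`, from
`|θ'(u) − ½ log(u/2π)| ≤ 2/u` (`abs_riemannSiegelThetaDeriv_sub_log_le`) — the content of the printed (3.4)
`φ̃_h(t) = (t/2) log(t/2) − (t/2)(log 2π + 1) + … + O(1/(|t|+1))` at `h = 0`.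
[cite: Lagarias2005, proof of Theorem 3.1, (3.4) (arXiv p. 9; held text p0007 L103–105)] -/
theorem abs_riemannSiegelTheta_sub_sub_main_le {T : ℝ} (hT : 2 ≤ T) :
    |(riemannSiegelTheta T - riemannSiegelTheta 2) -
        (T / 2 * Real.log (T / (2 * π)) - T / 2 + (1 + Real.log π))| ≤ 2 * Real.log T := by
  have hπ := Real.pi_pos
  have hθint : ∀ a b : ℝ, IntervalIntegrable riemannSiegelThetaDeriv volume a b := fun a b ↦
    continuous_riemannSiegelThetaDeriv_holds.intervalIntegrable a b
  have h1 : riemannSiegelTheta T - riemannSiegelTheta 2 = ∫ u in (2:ℝ)..T, riemannSiegelThetaDeriv u := by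
    simp only [riemannSiegelTheta]
    rw [intervalIntegral.integral_interval_sub_left (hθint 0 T) (hθint 0 2)]
  -- the model integrand `½ log(u/2π)` and its integral
  have hmodel_cont : ContinuousOn (fun u : ℝ ↦ Real.log (u / (2 * π)) / 2) (uIcc 2 T) := by
    rw [uIcc_of_le hT]
    intro u hu
    have hu0 : u ≠ 0 := by linarith [hu.1]
    exact ((Real.continuousAt_log (by positivity)).comp (continuousAt_id.div_const _)
      |>.div_const _).continuousWithinAt
  have hmodel_int : IntervalIntegrable (fun u : ℝ ↦ Real.log (u / (2 * π)) / 2) volume 2 T :=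
    hmodel_cont.intervalIntegrable
  have h2 : ∫ u in (2:ℝ)..T, Real.log (u / (2 * π)) / 2 =
      T / 2 * Real.log (T / (2 * π)) - T / 2 + (1 + Real.log π) := by
    have hlog : ∀ u ∈ uIcc (2:ℝ) T, Real.log (u / (2 * π)) / 2 = (Real.log u - Real.log (2 * π)) / 2 := by
      intro u hu
      rw [uIcc_of_le hT] at hu
      rw [Real.log_div (by linarith [hu.1]) (by positivity)]
    rw [intervalIntegral.integral_congr hlog, intervalIntegral.integral_div,
      intervalIntegral.integral_sub intervalIntegral.intervalIntegrable_log' intervalIntegrable_const,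
      integral_log, intervalIntegral.integral_const, smul_eq_mul]
    have hT0 : T ≠ 0 := by linarith
    rw [Real.log_div hT0 (by positivity), Real.log_mul (by norm_num) hπ.ne']
    ring
  -- the difference
  have hbound : ∀ u ∈ Ioc (2:ℝ) T, ‖riemannSiegelThetaDeriv u - Real.log (u / (2 * π)) / 2‖ ≤ 2 * u⁻¹ := by
    intro u hu
    rw [Real.norm_eq_abs, ← div_eq_mul_inv]
    exact abs_riemannSiegelThetaDeriv_sub_log_le (by linarith [hu.1])
  have hinv_int : IntervalIntegrable (fun u : ℝ ↦ 2 * u⁻¹) volume 2 T := by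
    refine (ContinuousOn.intervalIntegrable ?_)
    rw [uIcc_of_le hT]
    exact fun u hu ↦ (continuousAt_const.mul (continuousAt_inv₀ (by linarith [hu.1]))).continuousWithinAt
  have h3 := intervalIntegral.norm_integral_le_of_norm_le hT (Filter.Eventually.of_forall hbound) hinv_int
  rw [intervalIntegral.integral_sub (hθint 2 T) hmodel_int, Real.norm_eq_abs, intervalIntegral.integral_const_mul,
    integral_inv_of_pos (by norm_num) (by linarith), h2] at h3
  rw [h1]
  refine h3.trans ?_
  rw [Real.log_div (by linarith) (by norm_num)]
  have hl2 : 0 < Real.log 2 := Real.log_pos (by norm_num)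
  linarith

/-- The horizontal `Γℝ'/Γℝ` pieces are `O_x(log T)`:
`|Im ∫_{1/2}^{x} Γℝ'/Γℝ(t + iy) dt| ≤ (x − ½)(½ log π + 4 + ½ log(x + y))` for `x ≥ ½`, `y ≥ 2` (the `h`-dependence
of the printed `O`-term in (3.4)). [cite: Lagarias2005, proof of Theorem 3.1, (3.3)–(3.4) (arXiv p. 9; held text p0007 L87–105)] -/
theorem abs_im_integral_logDeriv_Gammaℝ_horizontal_le {x y : ℝ} (hx : 1 / 2 ≤ x) (hy : 2 ≤ y) :
    |(∫ t in (1 / 2 : ℝ)..x, logDeriv Gammaℝ ((t : ℂ) + y * I)).im| ≤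
      (x - 1 / 2) * (Real.log π / 2 + 4 + Real.log (x + y) / 2) := by
  have hb : ∀ t ∈ Ι (1 / 2 : ℝ) x, ‖logDeriv Gammaℝ ((t : ℂ) + y * I)‖ ≤
      Real.log π / 2 + 4 + Real.log (x + y) / 2 := by
    intro t ht
    rw [uIoc_of_le hx] at ht
    have ht0 : 0 < t := by linarith [ht.1]
    refine (norm_logDeriv_Gammaℝ_le_log ht0 hy).trans ?_
    have := Real.log_le_log (by linarith) (by linarith [ht.2] : t + y ≤ x + y)
    linarith
  have h := intervalIntegral.norm_integral_le_of_norm_le_const hb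
  rw [abs_of_nonneg (by linarith : (0:ℝ) ≤ x - 1 / 2)] at h
  refine (Complex.abs_im_le_norm _).trans ?_
  linarith

/-! ### C3. The `ζ` factor: Backlund -/

/-- On `Re s = x ≥ 2` the real part of `ζ` is positive, so the phase of `ζ` along any vertical segment there
changes by at most `π`: `|∫_c^d Re ζ'/ζ(x + iu) du| ≤ π` (Titchmarsh §9.3: `Re ζ(2 + it) ≥ 2 − π²/6 > 0`, so the
variation of `arg ζ` along `Re s = 2` is `< π`). [cite: Titchmarsh1986, §9.3 (proof of Thm. 9.3)] -/
theorem abs_integral_re_logDeriv_zeta_vertical_le {x c d : ℝ} (hx : 2 ≤ x) (hcd : c ≤ d) :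
    |∫ u in c..d, (deriv riemannZeta ((x : ℂ) + u * I) / riemannZeta ((x : ℂ) + u * I)).re| ≤ π := by
  have hne1 : ∀ y : ℝ, (x : ℂ) + y * I ≠ 1 := fun y h ↦ by
    have := congrArg Complex.re h; simp at this; linarith
  have hpos : ∀ y : ℝ, 0 < (riemannZeta ((x : ℂ) + y * I)).re := fun y ↦
    Nicolas.riemannZeta_re_pos_of_two_le (by simpa using hx)
  have han : ∀ y ∈ Icc c d, AnalyticAt ℂ riemannZeta ((x : ℂ) + y * I) := fun y _ ↦
    analyticOn_riemannZeta _ (hne1 y)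
  have hslit : ∀ y ∈ Icc c d, riemannZeta ((x : ℂ) + y * I) ∈ slitPlane := fun y _ ↦ Or.inl (hpos y)
  have h := Literature.Analysis.Complex.integral_logDeriv_vertical (g := riemannZeta) x hcd han hslit
  have hint : IntervalIntegrable
      (fun u : ℝ ↦ deriv riemannZeta ((x : ℂ) + u * I) / riemannZeta ((x : ℂ) + u * I)) volume c d :=
    Literature.Analysis.Complex.intervalIntegrable_of_continuousAt_vertical
      (F := fun s ↦ deriv riemannZeta s / riemannZeta s) x hcd
      fun y _ ↦ continuousAt_logDeriv_riemannZeta (hne1 y) fun h0 ↦ by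
        have := hpos y; rw [h0, zero_re] at this; exact lt_irrefl _ this
  have hre : (∫ u in c..d, (deriv riemannZeta ((x : ℂ) + u * I) / riemannZeta ((x : ℂ) + u * I)).re) =
      (I * ∫ u in c..d, deriv riemannZeta ((x : ℂ) + u * I) / riemannZeta ((x : ℂ) + u * I)).im := by
    rw [← re_intervalIntegral_eq hint, mul_im, I_re, I_im]; ring
  rw [hre, h, sub_im, log_im, log_im]
  have a1 := abs_arg_le_pi_div_two_iff.2 (hpos d).le
  have a2 := abs_arg_le_pi_div_two_iff.2 (hpos c).le
  have := abs_sub (arg (riemannZeta ((x : ℂ) + d * I))) (arg (riemannZeta ((x : ℂ) + c * I)))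
  linarith

/-- **Backlund's bound on a horizontal segment `[x, 2] × {T}`** (`½ ≤ x ≤ 2`, `T ≥ 2`, `ζ ≠ 0` on the segment):
`|Im ∫_x^2 ζ'/ζ(t+iT) dt| ≤ π (log(120 (T+4))/log(7/6) + 1)` — Jensen on the discs `|s − (2+iT)| ≤ 3/2 < 7/4`
exactly as in the tree's `abs_im_integral_logDeriv_riemannZeta_horizontal_le` (which is the case `x = ½`).
[cite: Titchmarsh1986, Thm. 9.4] -/
theorem abs_im_integral_logDeriv_zeta_horizontal_le {x T : ℝ} (hx : 1 / 2 ≤ x) (hx2 : x ≤ 2) (hT : 2 ≤ T)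
    (hζ : ∀ t ∈ Icc x 2, riemannZeta (t + T * I) ≠ 0) :
    |(∫ t in x..2, deriv riemannZeta (t + T * I) / riemannZeta (t + T * I)).im| ≤
      π * (Real.log (120 * (T + 4)) / Real.log (7 / 6) + 1) := by
  have hT' : 2 ≤ |T| := by rwa [abs_of_nonneg (by linarith)]
  have hTabs : |T| = T := abs_of_nonneg (by linarith)
  have hM : (1 : ℝ) ≤ 40 * (T + 4) := by linarith
  have hsub : closedBall ((2 : ℂ) + T * I) (7 / 4) ⊆ closedBall ((2 : ℂ) + T * I) (39 / 20) :=
    closedBall_subset_closedBall (by norm_num)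
  have hg : ∀ z ∈ closedBall (((2 : ℝ) : ℂ) + T * I) (7 / 4), AnalyticAt ℂ riemannZeta z := by
    intro z hz
    simp only [ofReal_ofNat] at hz
    exact analyticOnNhd_riemannZeta_jensenDisc hT' (by norm_num) z hz
  have hgM : ∀ z ∈ closedBall (((2 : ℝ) : ℂ) + T * I) (7 / 4), ‖riemannZeta z‖ ≤ 40 * (T + 4) := by
    intro z hz
    simp only [ofReal_ofNat] at hz
    have := norm_riemannZeta_le_of_mem_jensenDisc hT' (hsub hz)
    rwa [hTabs] at this
  have hc : riemannZeta ((2 : ℝ) + T * I) ≠ 0 := by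
    simpa using riemannZeta_two_add_ne_zero T
  have h := Literature.Analysis.Complex.abs_im_integral_logDeriv_le_backlund (g := riemannZeta) (c := 2) (y := T)
    (r := 3 / 2) (R := 7 / 4) (M := 40 * (T + 4)) (a := x) (b := 2) (by norm_num) (by norm_num)
    hM hg hgM hc hx2 (by linarith) (by norm_num) hζ
  refine h.trans ?_
  have hlog76 : 0 < Real.log (7 / 4 / (3 / 2)) := Real.log_pos (by norm_num)
  have hnorm : 1 / 3 ≤ ‖riemannZeta ((2 : ℝ) + T * I)‖ := by
    simpa using one_third_le_norm_riemannZeta_two_add T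
  have hpos : 0 < ‖riemannZeta ((2 : ℝ) + T * I)‖ := by linarith
  have h1 : Real.log (40 * (T + 4) / ‖riemannZeta ((2 : ℝ) + T * I)‖) ≤ Real.log (120 * (T + 4)) := by
    apply Real.log_le_log (div_pos (by linarith) hpos)
    rw [div_le_iff₀ hpos]
    nlinarith
  have h2 : (7 : ℝ) / 4 / (3 / 2) = 7 / 6 := by norm_num
  rw [h2] at hlog76 ⊢
  have := div_le_div_of_nonneg_right h1 hlog76.le
  nlinarith [Real.pi_pos]

/-- **The `ζ` factor along `Re s = x`, `½ ≤ x ≤ 2`, above a zero-free half-plane `Re s ≥ x`.** By Cauchy–Goursat on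
`[x, 2] × [2, T]` for the holomorphic `ζ'/ζ`:
`∫₂ᵀ Re ζ'/ζ(x+iu) du = ∫₂ᵀ Re ζ'/ζ(2+iu) du + Im ∫_x^2 ζ'/ζ(t+2i) dt − Im ∫_x^2 ζ'/ζ(t+iT) dt` (the path
deformation of Titchmarsh §9.3–9.4 defining `arg ζ(σ + iT)` by continuous variation along `2 → 2 + iT → σ + iT`).
[cite: Titchmarsh1986, §9.3–9.4 (Thms. 9.3, 9.4)] -/
theorem integral_re_logDeriv_zeta_vertical_eq {x T : ℝ} (hx2 : x ≤ 2) (hT : 2 ≤ T)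
    (hζ : ∀ s : ℂ, x ≤ s.re → riemannZeta s ≠ 0) :
    ∫ u in (2:ℝ)..T, (deriv riemannZeta ((x : ℂ) + u * I) / riemannZeta ((x : ℂ) + u * I)).re =
      (∫ u in (2:ℝ)..T, (deriv riemannZeta ((2 : ℝ) + u * I) / riemannZeta ((2 : ℝ) + u * I)).re) +
        (∫ t in x..2, deriv riemannZeta ((t : ℂ) + 2 * I) / riemannZeta ((t : ℂ) + 2 * I)).im -
        (∫ t in x..2, deriv riemannZeta ((t : ℂ) + T * I) / riemannZeta ((t : ℂ) + T * I)).im := by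
  set Z : ℂ → ℂ := fun s ↦ deriv riemannZeta s / riemannZeta s with hZ
  have hpt : ∀ z ∈ (Icc x 2 ×ℂ Icc 2 T), z ≠ 1 ∧ riemannZeta z ≠ 0 := by
    intro z hz
    obtain ⟨⟨hz1, _⟩, hz3, _⟩ := mem_reProdIm.1 hz
    refine ⟨fun h ↦ ?_, hζ z hz1⟩
    rw [h] at hz3; simp at hz3; linarith
  have hdiff : DifferentiableOn ℂ Z (Icc x 2 ×ℂ Icc 2 T) := by
    intro z hz
    obtain ⟨hz1, hz0⟩ := hpt z hz
    exact ((analyticOn_riemannZeta z hz1).deriv.differentiableAt.div (differentiableAt_riemannZeta hz1)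
      hz0).differentiableWithinAt
  have hCG := Literature.Analysis.Complex.rectBoundaryIntegral_eq_zero_of_differentiableOn (F := Z)
    (a := x) (b := 2) (c := 2) (d := T) hx2 hT hdiff
  rw [Literature.Analysis.Complex.rectBoundaryIntegral_def] at hCG
  simp only [ofReal_ofNat] at hCG
  have hcont : ∀ (x' y : ℝ), x ≤ x' → 2 ≤ y → ContinuousAt Z ((x' : ℂ) + y * I) := by
    intro x' y hx' hy
    have hne1 : (x' : ℂ) + y * I ≠ 1 := fun h ↦ by
      have := congrArg Complex.im h; simp at this; linarith
    exact continuousAt_logDeriv_riemannZeta hne1 (hζ _ (by simpa using hx'))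
  have hintv : ∀ x' : ℝ, x ≤ x' → IntervalIntegrable (fun y : ℝ ↦ Z ((x' : ℂ) + y * I)) volume 2 T :=
    fun x' hx' ↦ Literature.Analysis.Complex.intervalIntegrable_of_continuousAt_vertical (F := Z) x' hT
      fun y hy ↦ hcont x' y hx' hy.1
  have hright : (I * ∫ y in (2:ℝ)..T, Z ((2 : ℂ) + y * I)).im =
      ∫ u in (2:ℝ)..T, (Z (((2 : ℝ) : ℂ) + u * I)).re := by
    rw [mul_im, I_re, I_im, zero_mul, one_mul, zero_add, ← ofReal_ofNat, re_intervalIntegral_eq (hintv 2 hx2)]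
  have hleft : (I * ∫ y in (2:ℝ)..T, Z ((x : ℂ) + y * I)).im = ∫ u in (2:ℝ)..T, (Z ((x : ℂ) + u * I)).re := by
    rw [mul_im, I_re, I_im, zero_mul, one_mul, zero_add, re_intervalIntegral_eq (hintv x le_rfl)]
  have him := congrArg Complex.im hCG
  simp only [sub_im, add_im, zero_im] at him
  rw [hright, hleft] at him
  simp only [hZ, ofReal_ofNat] at him ⊢
  linarith

/-- **The `ζ` factor is `O_x(log T)`** along `Re s = x` (`x ≥ ½`), given that `ζ` has no zeros in the closed
half-plane `Re s ≥ x`: for some `C` and all `T ≥ 2`, `|∫₂ᵀ Re ζ'/ζ(x+iu) du| ≤ C log T` ("It is a standard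
estimate that in a half-plane … containing no zeros there holds `arg ζ(½ + h + it) = O(log |t|)`").
[cite: Lagarias2005, proof of Theorem 3.1 (arXiv p. 9; held text p0007)] -/
theorem exists_abs_integral_re_logDeriv_zeta_vertical_le {x : ℝ} (hx : 1 / 2 ≤ x)
    (hζ : ∀ s : ℂ, x ≤ s.re → riemannZeta s ≠ 0) :
    ∃ C : ℝ, ∀ T : ℝ, 2 ≤ T →
      |∫ u in (2:ℝ)..T, (deriv riemannZeta ((x : ℂ) + u * I) / riemannZeta ((x : ℂ) + u * I)).re| ≤
        C * Real.log T := by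
  have hπ := Real.pi_pos
  have hl2 : 0 < Real.log 2 := Real.log_pos (by norm_num)
  rcases le_or_gt x 2 with hx2 | hx2
  · -- rectangle `[x, 2] × [2, T]`
    set K : ℝ := |(∫ t in x..2, deriv riemannZeta ((t : ℂ) + 2 * I) / riemannZeta ((t : ℂ) + 2 * I)).im| with hK
    -- `log(120 (T + 4)) ≤ log 360 + log T` for `T ≥ 2`
    refine ⟨(π + K + π * (Real.log 360 / Real.log (7 / 6) + 1)) / Real.log 2 + π / Real.log (7 / 6), ?_⟩
    intro T hT
    have hlT : Real.log 2 ≤ Real.log T := Real.log_le_log (by norm_num) hT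
    have hl76 : 0 < Real.log (7 / 6) := Real.log_pos (by norm_num)
    rw [integral_re_logDeriv_zeta_vertical_eq hx2 hT hζ]
    have h1 := abs_integral_re_logDeriv_zeta_vertical_le (x := 2) (c := 2) (d := T) le_rfl hT
    have h3 := abs_im_integral_logDeriv_zeta_horizontal_le hx hx2 hT
      (fun t ht ↦ hζ _ (by simpa using ht.1))
    have hlog : Real.log (120 * (T + 4)) ≤ Real.log 360 + Real.log T := by
      rw [← Real.log_mul (by norm_num) (by linarith)]
      exact Real.log_le_log (by linarith) (by linarith)
    have h3' : |(∫ t in x..2, deriv riemannZeta ((t : ℂ) + T * I) / riemannZeta ((t : ℂ) + T * I)).im| ≤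
        π * (Real.log 360 / Real.log (7 / 6) + 1) + π / Real.log (7 / 6) * Real.log T := by
      refine h3.trans ?_
      have := div_le_div_of_nonneg_right hlog hl76.le
      rw [add_div] at this
      have e : π * (Real.log (120 * (T + 4)) / Real.log (7 / 6) + 1) ≤
          π * ((Real.log 360 / Real.log (7 / 6) + Real.log T / Real.log (7 / 6)) + 1) := by
        gcongr
      refine e.trans (le_of_eq ?_)
      ring
    have habs := abs_add_three
      (∫ u in (2:ℝ)..T, (deriv riemannZeta (((2:ℝ) : ℂ) + u * I) / riemannZeta (((2:ℝ) : ℂ) + u * I)).re)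
      ((∫ t in x..2, deriv riemannZeta ((t : ℂ) + 2 * I) / riemannZeta ((t : ℂ) + 2 * I)).im)
      (-(∫ t in x..2, deriv riemannZeta ((t : ℂ) + T * I) / riemannZeta ((t : ℂ) + T * I)).im)
    rw [abs_neg, ← sub_eq_add_neg] at habs
    have hsum : |∫ u in (2:ℝ)..T, (deriv riemannZeta (((2:ℝ) : ℂ) + u * I) / riemannZeta (((2:ℝ) : ℂ) + u * I)).re| +
        K + |(∫ t in x..2, deriv riemannZeta ((t : ℂ) + T * I) / riemannZeta ((t : ℂ) + T * I)).im| ≤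
        (π + K + π * (Real.log 360 / Real.log (7 / 6) + 1)) + π / Real.log (7 / 6) * Real.log T := by
      linarith
    have hA : 0 ≤ π + K + π * (Real.log 360 / Real.log (7 / 6) + 1) := by
      have : 0 ≤ K := abs_nonneg _
      have : 0 ≤ Real.log 360 / Real.log (7 / 6) := div_nonneg (Real.log_nonneg (by norm_num)) hl76.le
      positivity
    exact (habs.trans hsum).trans (const_add_mul_log_le hA hT)
  · -- `x > 2`: `Re ζ > 0` on the line
    refine ⟨π / Real.log 2, fun T hT ↦ ?_⟩
    have hlT : Real.log 2 ≤ Real.log T := Real.log_le_log (by norm_num) hT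
    have h1 := abs_integral_re_logDeriv_zeta_vertical_le (x := x) (c := 2) (d := T) hx2.le hT
    calc _ ≤ π := h1
      _ = π / Real.log 2 * Real.log 2 := by field_simp
      _ ≤ π / Real.log 2 * Real.log T := mul_le_mul_of_nonneg_left hlT (by positivity)

/-! ### C4. The phase of `ξ` along `Re s = x`: `φ_x(T) = (T/2) log(T/2π) − T/2 + O_x(log T)` -/

/-- Real parts of functions continuous along a vertical segment are interval integrable there. [folklore] -/
private theorem intervalIntegrable_re_vertical {F : ℂ → ℂ} (x : ℝ) {c d : ℝ} (hcd : c ≤ d)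
    (h : ∀ y ∈ Icc c d, ContinuousAt F ((x : ℂ) + y * I)) :
    IntervalIntegrable (fun y : ℝ ↦ (F ((x : ℂ) + y * I)).re) volume c d := by
  apply ContinuousOn.intervalIntegrable
  rw [uIcc_of_le hcd]
  intro y hy
  have h1 : ContinuousAt (fun y : ℝ ↦ (x : ℂ) + y * I) y := by fun_prop
  exact (Complex.continuous_re.continuousAt.comp
    ((h y hy).comp (f := fun y : ℝ ↦ (x : ℂ) + y * I) h1)).continuousWithinAt

/-- **The phase of `ξ` on a zero-free vertical line** (the heart of the printed proof of Theorem 3.1: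
"`φ_h(t) = φ̃_h(t) + π + arg ζ(½ + h + it) + O(1/(|t|+1))`", Stirling for the `Γ`-factor and
`arg ζ = O(log |t|)` on a zero-free half-plane): for `x ≥ ½` such that `ζ` has no zeros in the closed half-plane
`Re s ≥ x` and `ξ ≠ 0` on `Re s = x`, there is `C` with
`|∫₀ᵀ Re ξ'/ξ(x + iu) du − ((T/2) log(T/2π) − T/2)| ≤ C log T` for all `T ≥ 2`. The `Γ`-factor is routed
through the tree's `θ` (Cauchy–Goursat to the critical line) instead of Stirling's formula for `log Γ` — the same
analytic content. [cite: Lagarias2005, proof of Theorem 3.1, (3.3)–(3.5) (arXiv p. 9; held text p0007)] -/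
theorem exists_abs_xiPhase_sub_main_le {x : ℝ} (hx : 1 / 2 ≤ x)
    (hζ : ∀ s : ℂ, x ≤ s.re → riemannZeta s ≠ 0) (hξ : ∀ t : ℝ, riemannXi ((x : ℂ) + t * I) ≠ 0) :
    ∃ C : ℝ, ∀ T : ℝ, 2 ≤ T →
      |(∫ u in (0:ℝ)..T, (logDeriv riemannXi ((x : ℂ) + u * I)).re) -
          (T / 2 * Real.log (T / (2 * π)) - T / 2)| ≤ C * Real.log T := by
  have hx0 : 0 < x := by linarith
  have hπ := Real.pi_pos
  -- continuity of the phase velocity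
  have hcontv : Continuous fun u : ℝ ↦ (logDeriv riemannXi ((x : ℂ) + u * I)).re := by
    refine Complex.continuous_re.comp (continuous_iff_continuousAt.2 fun u ↦ ?_)
    have h1 : ContinuousAt (fun u : ℝ ↦ (x : ℂ) + u * I) u := by fun_prop
    have h2 : ContinuousAt (logDeriv riemannXi) ((x : ℂ) + u * I) := continuousAt_logDeriv_riemannXi (hξ u)
    exact h2.comp (f := fun u : ℝ ↦ (x : ℂ) + u * I) h1
  have hint : ∀ a b : ℝ, IntervalIntegrable (fun u : ℝ ↦ (logDeriv riemannXi ((x : ℂ) + u * I)).re) volume a b :=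
    fun a b ↦ hcontv.intervalIntegrable a b
  obtain ⟨Cζ, hCζ⟩ := exists_abs_integral_re_logDeriv_zeta_vertical_le hx hζ
  set c₀ : ℝ := ∫ u in (0:ℝ)..2, (logDeriv riemannXi ((x : ℂ) + u * I)).re with hc₀
  set H₂ : ℝ := (∫ t in (1 / 2 : ℝ)..x, logDeriv Gammaℝ ((t : ℂ) + 2 * I)).im with hH₂
  set A : ℝ := |c₀| + 4 * π + (1 + Real.log π) +
    (x - 1 / 2) * (Real.log π / 2 + 4 + Real.log (x + 1) / 2) + |H₂| with hA
  set B : ℝ := 2 + (x - 1 / 2) / 2 + Cζ with hB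
  have hlogπ : 0 ≤ Real.log π := Real.log_nonneg (by linarith [Real.pi_gt_three])
  have hA0 : 0 ≤ A := by
    have h1 : 0 ≤ (x - 1 / 2) * (Real.log π / 2 + 4 + Real.log (x + 1) / 2) :=
      mul_nonneg (by linarith) (by linarith [Real.log_nonneg (by linarith : (1:ℝ) ≤ x + 1)])
    have h2 := abs_nonneg c₀
    have h3 := abs_nonneg H₂
    simp only [hA]
    linarith
  refine ⟨A / Real.log 2 + B, fun T hT ↦ ?_⟩
  -- split at `u = 2`
  have hsplit : (∫ u in (0:ℝ)..T, (logDeriv riemannXi ((x : ℂ) + u * I)).re) =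
      c₀ + ∫ u in (2:ℝ)..T, (logDeriv riemannXi ((x : ℂ) + u * I)).re := by
    rw [hc₀, intervalIntegral.integral_add_adjacent_intervals (hint 0 2) (hint 2 T)]
  -- the decomposition `ξ'/ξ = 1/s + 1/(s−1) + Γℝ'/Γℝ + ζ'/ζ` on the segment
  have hne1 : ∀ u ∈ Icc (2:ℝ) T, (x : ℂ) + u * I ≠ 1 := fun u hu h ↦ by
    have := congrArg Complex.im h; simp at this; linarith [hu.1]
  have hne0 : ∀ u ∈ Icc (2:ℝ) T, (x : ℂ) + u * I ≠ 0 := fun u hu h ↦ by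
    have := congrArg Complex.im h; simp at this; linarith [hu.1]
  have hdec : ∀ u ∈ uIcc (2:ℝ) T, (logDeriv riemannXi ((x : ℂ) + u * I)).re =
      ((((x : ℂ) + u * I)⁻¹).re + (((x : ℂ) + u * I - 1)⁻¹).re) +
        (logDeriv Gammaℝ ((x : ℂ) + u * I)).re +
        (deriv riemannZeta ((x : ℂ) + u * I) / riemannZeta ((x : ℂ) + u * I)).re := by
    intro u hu
    rw [uIcc_of_le hT] at hu
    have hs : 0 < ((x : ℂ) + u * I).re := by simp [hx0]
    rw [logDeriv_apply, logDeriv_riemannXi_eq_add_logDeriv_riemannZeta hs (hne1 u hu) (hζ _ (by simp))]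
    simp only [add_re]
  -- integrability of the four pieces on `[2, T]`
  have hI0 : IntervalIntegrable (fun u : ℝ ↦ (((x : ℂ) + u * I)⁻¹).re) volume 2 T :=
    intervalIntegrable_re_vertical (F := fun s ↦ s⁻¹) x hT fun u hu ↦ continuousAt_id.inv₀ (hne0 u hu)
  have hI1 : IntervalIntegrable (fun u : ℝ ↦ (((x : ℂ) + u * I - 1)⁻¹).re) volume 2 T :=
    intervalIntegrable_re_vertical (F := fun s ↦ (s - 1)⁻¹) x hT fun u hu ↦
      (continuousAt_id.sub continuousAt_const).inv₀ (sub_ne_zero.2 (hne1 u hu))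
  have hIG : IntervalIntegrable (fun u : ℝ ↦ (logDeriv Gammaℝ ((x : ℂ) + u * I)).re) volume 2 T :=
    intervalIntegrable_re_vertical (F := logDeriv Gammaℝ) x hT fun u _ ↦
      (analyticAt_logDeriv_Gammaℝ (by simp [hx0])).continuousAt
  have hIZ : IntervalIntegrable
      (fun u : ℝ ↦ (deriv riemannZeta ((x : ℂ) + u * I) / riemannZeta ((x : ℂ) + u * I)).re) volume 2 T :=
    intervalIntegrable_re_vertical (F := fun s ↦ deriv riemannZeta s / riemannZeta s) x hT fun u hu ↦
      continuousAt_logDeriv_riemannZeta (hne1 u hu) (hζ _ (by simp))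
  have hsum : (∫ u in (2:ℝ)..T, (logDeriv riemannXi ((x : ℂ) + u * I)).re) =
      (∫ u in (2:ℝ)..T, (((x : ℂ) + u * I)⁻¹).re) + (∫ u in (2:ℝ)..T, (((x : ℂ) + u * I - 1)⁻¹).re) +
        (∫ u in (2:ℝ)..T, (logDeriv Gammaℝ ((x : ℂ) + u * I)).re) +
        (∫ u in (2:ℝ)..T, (deriv riemannZeta ((x : ℂ) + u * I) / riemannZeta ((x : ℂ) + u * I)).re) := by
    rw [intervalIntegral.integral_congr hdec, intervalIntegral.integral_add ((hI0.add hI1).add hIG) hIZ,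
      intervalIntegral.integral_add (hI0.add hI1) hIG, intervalIntegral.integral_add hI0 hI1]
  -- the bounds on the pieces
  have b0 := abs_integral_re_inv_sub_vertical_le x 0 hT
  have b1 := abs_integral_re_inv_sub_vertical_le x 1 hT
  simp only [ofReal_zero, sub_zero] at b0
  simp only [ofReal_one] at b1
  have bG := integral_re_logDeriv_Gammaℝ_vertical_eq hx hT
  have bθ := abs_riemannSiegelTheta_sub_sub_main_le hT
  have bH := abs_im_integral_logDeriv_Gammaℝ_horizontal_le (y := T) hx hT
  have bZ := hCζ T hT
  have hlogT0 : 0 ≤ Real.log T := Real.log_nonneg (by linarith)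
  have hlogxT : Real.log (x + T) ≤ Real.log (x + 1) + Real.log T := by
    rw [← Real.log_mul (by linarith) (by linarith)]
    exact Real.log_le_log (by linarith) (by nlinarith)
  have bH' : |(∫ t in (1 / 2 : ℝ)..x, logDeriv Gammaℝ ((t : ℂ) + T * I)).im| ≤
      (x - 1 / 2) * (Real.log π / 2 + 4 + Real.log (x + 1) / 2) + (x - 1 / 2) / 2 * Real.log T := by
    refine bH.trans ?_
    have := mul_le_mul_of_nonneg_left hlogxT (by linarith : (0:ℝ) ≤ x - 1 / 2)
    have e : (x - 1 / 2) * (Real.log π / 2 + 4 + Real.log (x + T) / 2) =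
        (x - 1 / 2) * (Real.log π / 2 + 4) + (x - 1 / 2) * Real.log (x + T) / 2 := by ring
    have e' : (x - 1 / 2) * (Real.log π / 2 + 4 + Real.log (x + 1) / 2) + (x - 1 / 2) / 2 * Real.log T =
        (x - 1 / 2) * (Real.log π / 2 + 4) + (x - 1 / 2) * (Real.log (x + 1) + Real.log T) / 2 := by ring
    rw [e, e']
    linarith
  -- assemble
  rw [hsplit, hsum, bG]
  refine le_trans ?_ (const_add_mul_log_le hA0 hT)
  have hBexp : B * Real.log T = 2 * Real.log T + (x - 1 / 2) / 2 * Real.log T + Cζ * Real.log T := by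
    simp only [hB]; ring
  rw [hBexp]
  rw [abs_le] at b0 b1 bθ bH' bZ ⊢
  obtain ⟨b0l, b0r⟩ := b0
  obtain ⟨b1l, b1r⟩ := b1
  obtain ⟨bθl, bθr⟩ := bθ
  obtain ⟨bHl, bHr⟩ := bH'
  obtain ⟨bZl, bZr⟩ := bZ
  have hc₀l := neg_abs_le c₀
  have hc₀r := le_abs_self c₀
  have hH₂l := neg_abs_le H₂
  have hH₂r := le_abs_self H₂
  simp only [hA]
  constructor <;> linarith

/-! ## D. Theorem 3.1: counting the zeros of `A_{h,θ}`, `B_{h,θ}` by the phase of `ξ(½ + h + it)` -/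

/-- **Core of Theorem 3.1** (both parts): for `h > 0` such that `E_{h,θ}` satisfies (2.6) for every `θ`, the phase
velocity `Re ξ'/ξ(½ + h + it)` is positive for all `t`, and `ζ` has no zeros in the closed half-plane
`Re s ≥ ½ + h`, there is `C = C(h)` with `|N(T, A_{h,θ}) − (T log T − (log 2π + 1)T)/π| ≤ C log T` and the same
for `B_{h,θ}`, for all real `θ` and all `T ≥ 2`. Printed proof: zeros of `A_{h,θ}` (resp. `B_{h,θ}`) on the
line are the solutions of `φ_h(γ) ≡ π/2 + θ` (resp. `≡ θ`) `(mod π)` with `φ_h` strictly increasing, so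
`|N_h(T) − (φ_h(T) − φ_h(−T))/π| ≤ 2`; `φ_h` is odd; and `φ_h(T) = (T/2) log(T/2π) − T/2 + O(log T)`
(`exists_abs_xiPhase_sub_main_le`). [cite: Lagarias2005, Theorem 3.1 and its proof (arXiv p. 9; held text p0007 L10–L135)] -/
theorem stripZeroCount_diffXi_estimate {h : ℝ} (hh : 0 < h)
    (hHB : ∀ θ : ℝ, ∀ s : ℂ, 1 / 2 < s.re → ‖diffXiErot h θ (1 - conj s)‖ < ‖diffXiErot h θ s‖)
    (hpos : ∀ t : ℝ, 0 < (logDeriv riemannXi (1 / 2 + t * I + h)).re)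
    (hζ : ∀ s : ℂ, 1 / 2 + h ≤ s.re → riemannZeta s ≠ 0) :
    ∃ C : ℝ, ∀ θ T : ℝ, 2 ≤ T →
      |(stripZeroCount (diffXiArot h θ) T : ℝ) - lagariasZeroCountMain T| ≤ C * Real.log T ∧
        |(stripZeroCount (diffXiBrot h θ) T : ℝ) - lagariasZeroCountMain T| ≤ C * Real.log T := by
  have hπ := Real.pi_pos
  set x : ℝ := 1 / 2 + h with hxdef
  have hx : 1 / 2 ≤ x := by linarith
  have hpt : ∀ t : ℝ, (1 / 2 : ℂ) + t * I + h = (x : ℂ) + t * I := fun t ↦ by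
    rw [hxdef]; push_cast; ring
  have hpos' : ∀ t : ℝ, 0 < (logDeriv riemannXi ((x : ℂ) + t * I)).re := fun t ↦ by
    rw [← hpt]; exact hpos t
  have hξ : ∀ t : ℝ, riemannXi ((x : ℂ) + t * I) ≠ 0 := fun t h0 ↦ by
    have := hpos' t
    rw [logDeriv_apply, h0, div_zero, zero_re] at this
    exact lt_irrefl _ this
  obtain ⟨C₀, hC₀⟩ := exists_abs_xiPhase_sub_main_le hx hζ hξ
  -- the phase `φ(t) = ∫₀ᵗ Re ξ'/ξ(x + iu) du`: continuous, strictly increasing, odd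
  have hcontv : Continuous fun u : ℝ ↦ (logDeriv riemannXi ((x : ℂ) + u * I)).re := by
    refine Complex.continuous_re.comp (continuous_iff_continuousAt.2 fun u ↦ ?_)
    have h1 : ContinuousAt (fun u : ℝ ↦ (x : ℂ) + u * I) u := by fun_prop
    have h2 : ContinuousAt (logDeriv riemannXi) ((x : ℂ) + u * I) := continuousAt_logDeriv_riemannXi (hξ u)
    exact h2.comp (f := fun u : ℝ ↦ (x : ℂ) + u * I) h1
  set φ : ℝ → ℝ := fun t ↦ ∫ u in (0:ℝ)..t, (logDeriv riemannXi ((x : ℂ) + u * I)).re with hφ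
  have hφd : ∀ t : ℝ, HasDerivAt φ ((logDeriv riemannXi ((x : ℂ) + t * I)).re) t := fun t ↦
    (hcontv.integral_hasStrictDerivAt 0 t).hasDerivAt
  have hφc : Continuous φ := continuous_iff_continuousAt.2 fun t ↦ (hφd t).continuousAt
  have hφmono : StrictMono φ :=
    strictMono_of_deriv_pos fun t ↦ by rw [(hφd t).deriv]; exact hpos' t
  have hv_even : ∀ u : ℝ, (logDeriv riemannXi ((x : ℂ) + (-u : ℝ) * I)).re =
      (logDeriv riemannXi ((x : ℂ) + u * I)).re := by
    intro u
    have e : (x : ℂ) + (-u : ℝ) * I = conj ((x : ℂ) + u * I) := by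
      apply Complex.ext <;> simp
    rw [e, logDeriv_riemannXi_conj, Complex.conj_re]
  have hφodd : ∀ t : ℝ, φ (-t) = -φ t := by
    intro t
    simp only [hφ]
    calc ∫ u in (0:ℝ)..-t, (logDeriv riemannXi ((x : ℂ) + u * I)).re
        = ∫ u in (0:ℝ)..-t, (logDeriv riemannXi ((x : ℂ) + (-u : ℝ) * I)).re := by
          refine intervalIntegral.integral_congr fun u _ ↦ (hv_even u).symm
      _ = ∫ u in t..0, (logDeriv riemannXi ((x : ℂ) + u * I)).re := by
          rw [intervalIntegral.integral_comp_neg (fun u : ℝ ↦ (logDeriv riemannXi ((x : ℂ) + u * I)).re)]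
          simp
      _ = -∫ u in (0:ℝ)..t, (logDeriv riemannXi ((x : ℂ) + u * I)).re := intervalIntegral.integral_symm _ _
  refine ⟨1 / Real.log 2 + 2 / π * C₀, fun θ T hT ↦ ?_⟩
  have hTT : -T ≤ T := by linarith
  have hlog2 : 0 < Real.log 2 := Real.log_pos (by norm_num)
  have hlogT : Real.log 2 ≤ Real.log T := Real.log_le_log (by norm_num) hT
  -- the path `W(t) = e^{iθ} ξ(x + it)`
  set W : ℝ → ℂ := fun t ↦ cexp (θ * I) * riemannXi ((x : ℂ) + t * I) with hW
  set W' : ℝ → ℂ := fun t ↦ cexp (θ * I) * (deriv riemannXi ((x : ℂ) + t * I) * I) with hW'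
  have hWd : ∀ t, HasDerivAt W (W' t) t := by
    intro t
    have hp : HasDerivAt (fun t : ℝ ↦ (x : ℂ) + t * I) I t := by
      have := ((hasDerivAt_id t).ofReal_comp).mul_const I |>.const_add (x : ℂ)
      simpa using this
    have hξ' : HasDerivAt riemannXi (deriv riemannXi ((x : ℂ) + t * I)) ((x : ℂ) + t * I) :=
      (differentiable_riemannXi _).hasDerivAt
    have := (hξ'.comp t hp).const_mul (cexp (θ * I))
    simpa [hW, hW', Function.comp_def] using this
  have hW'c : Continuous W' :=
    continuous_const.mul ((continuous_deriv_riemannXi.comp (by fun_prop)).mul continuous_const)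
  have hWc : Continuous W := continuous_iff_continuousAt.2 fun t ↦ (hWd t).continuousAt
  have hW0 : ∀ t, W t ≠ 0 := fun t ↦ mul_ne_zero (Complex.exp_ne_zero _) (hξ t)
  have hquot : ∀ t, W' t / W t = I * logDeriv riemannXi ((x : ℂ) + t * I) := fun t ↦ by
    simp only [hW, hW']
    rw [mul_div_mul_left _ _ (Complex.exp_ne_zero _), logDeriv_apply]
    ring
  have hIm : ∀ t, (∫ u in (0:ℝ)..t, W' u / W u).im = φ t := by
    intro t
    have hi : IntervalIntegrable (fun u ↦ W' u / W u) volume 0 t := (hW'c.div hWc hW0).intervalIntegrable 0 t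
    rw [im_intervalIntegral_eq hi]
    simp only [hquot, mul_im, I_re, I_im, zero_mul, one_mul, zero_add, hφ]
  -- zero criteria on the critical line
  have hzA : ∀ t : ℝ, diffXiArot h θ (1 / 2 + t * I) = 0 ↔ Real.sin (arg (W 0) + φ t + π / 2) = 0 := by
    intro t
    rw [diffXiArot_critical_eq_zero_iff, hpt t]
    change (W t).re = 0 ↔ _
    rw [(re_eq_zero_iff_cos_of_hasDerivAt hWd hW'c hW0 t).1, hIm, Real.sin_add_pi_div_two]
  have hzB : ∀ t : ℝ, diffXiBrot h θ (1 / 2 + t * I) = 0 ↔ Real.sin (arg (W 0) + φ t) = 0 := by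
    intro t
    rw [diffXiBrot_critical_eq_zero_iff, hpt t]
    change (W t).im = 0 ↔ _
    rw [(re_eq_zero_iff_cos_of_hasDerivAt hWd hW'c hW0 t).2, hIm]
  -- counting along the monotone phases
  have hcA : ContinuousOn (fun t ↦ arg (W 0) + φ t + π / 2) (Icc (-T) T) :=
    ((continuous_const.add hφc).add continuous_const).continuousOn
  have hmA : StrictMonoOn (fun t ↦ arg (W 0) + φ t + π / 2) (Icc (-T) T) :=
    fun a _ b _ hab ↦ by simpa using hφmono hab
  have hcB : ContinuousOn (fun t ↦ arg (W 0) + φ t) (Icc (-T) T) := (continuous_const.add hφc).continuousOn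
  have hmB : StrictMonoOn (fun t ↦ arg (W 0) + φ t) (Icc (-T) T) :=
    fun a _ b _ hab ↦ by simpa using hφmono hab
  obtain ⟨hfinA, hcntA⟩ := finite_and_abs_ncard_sin_zero_sub_le hTT hcA hmA
  obtain ⟨hfinB, hcntB⟩ := finite_and_abs_ncard_sin_zero_sub_le hTT hcB hmB
  have eA : (arg (W 0) + φ T + π / 2 - (arg (W 0) + φ (-T) + π / 2)) / π = 2 * φ T / π := by
    rw [hφodd]; ring
  have eB : (arg (W 0) + φ T - (arg (W 0) + φ (-T))) / π = 2 * φ T / π := by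
    rw [hφodd]; ring
  simp only [eA] at hcntA
  simp only [eB] at hcntB
  -- the zero sets
  have hsetA : {t : ℝ | diffXiArot h θ (1 / 2 + t * I) = 0 ∧ |t| ≤ T} =
      {t : ℝ | t ∈ Icc (-T) T ∧ Real.sin (arg (W 0) + φ t + π / 2) = 0} := by
    ext t; rw [mem_setOf_eq, mem_setOf_eq, hzA, abs_le, mem_Icc, and_comm]
  have hsetB : {t : ℝ | diffXiBrot h θ (1 / 2 + t * I) = 0 ∧ |t| ≤ T} =
      {t : ℝ | t ∈ Icc (-T) T ∧ Real.sin (arg (W 0) + φ t) = 0} := by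
    ext t; rw [mem_setOf_eq, mem_setOf_eq, hzB, abs_le, mem_Icc, and_comm]
  obtain ⟨hlineA, hlineB, hsA, hsB, -⟩ := diffXi_zeroPattern_of_logDeriv_pos (hHB θ) hpos
  have hNA : (stripZeroCount (diffXiArot h θ) T : ℝ) =
      ({t : ℝ | t ∈ Icc (-T) T ∧ Real.sin (arg (W 0) + φ t + π / 2) = 0}.ncard : ℝ) := by
    rw [stripZeroCount_eq_ncard (differentiable_diffXiArot h θ) hlineA hsA (by rw [hsetA]; exact hfinA), hsetA]
  have hNB : (stripZeroCount (diffXiBrot h θ) T : ℝ) =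
      ({t : ℝ | t ∈ Icc (-T) T ∧ Real.sin (arg (W 0) + φ t) = 0}.ncard : ℝ) := by
    rw [stripZeroCount_eq_ncard (differentiable_diffXiBrot h θ) hlineB hsB (by rw [hsetB]; exact hfinB), hsetB]
  -- main term bookkeeping
  have hmain : lagariasZeroCountMain T = 2 / π * (T / 2 * Real.log (T / (2 * π)) - T / 2) := by
    rw [lagariasZeroCountMain, Real.log_div (by linarith) (by positivity)]
    field_simp
    ring
  have hφT := hC₀ T hT
  have h2 : |2 * φ T / π - 2 / π * (T / 2 * Real.log (T / (2 * π)) - T / 2)| ≤ 2 / π * (C₀ * Real.log T) := by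
    rw [show 2 * φ T / π - 2 / π * (T / 2 * Real.log (T / (2 * π)) - T / 2) =
      2 / π * (φ T - (T / 2 * Real.log (T / (2 * π)) - T / 2)) by ring, abs_mul, abs_of_pos (by positivity)]
    exact mul_le_mul_of_nonneg_left hφT (by positivity)
  have hone : (1 : ℝ) ≤ 1 / Real.log 2 * Real.log T := by
    rw [div_mul_eq_mul_div, le_div_iff₀ hlog2]; linarith
  have hfin : ∀ n : ℝ, |n - 2 * φ T / π| ≤ 1 → |n - lagariasZeroCountMain T| ≤
      (1 / Real.log 2 + 2 / π * C₀) * Real.log T := by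
    intro n hn
    rw [hmain]
    calc |n - 2 / π * (T / 2 * Real.log (T / (2 * π)) - T / 2)|
        ≤ |n - 2 * φ T / π| + |2 * φ T / π - 2 / π * (T / 2 * Real.log (T / (2 * π)) - T / 2)| :=
          abs_sub_le _ _ _
      _ ≤ 1 + 2 / π * (C₀ * Real.log T) := add_le_add hn h2
      _ ≤ (1 / Real.log 2 + 2 / π * C₀) * Real.log T := by nlinarith
  exact ⟨by rw [hNA]; exact hfin _ hcntA, by rw [hNB]; exact hfin _ hcntB⟩

end Lagarias2005Counting

open Lagarias2005Counting

/-- `Re(½ + it + h) = ½ + h`. [folklore] -/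
private theorem re_half_add_mul_I_add (h t : ℝ) : ((1 / 2 : ℂ) + t * I + h).re = 1 / 2 + h := by simp

/-- Theorem 3.1 for `(h, θ)` from the core estimate at `|h|` ("without loss of generality `h ≥ 0`":
`A_{−h,θ} = A_{h,−θ}`, `B_{−h,θ} = −B_{h,−θ}`, and `N(T, −F) = N(T, F)`). [cite: Lagarias2005, Theorem 3.1, proof (arXiv p. 9; held text p0007)] -/
theorem lagarias2005_thm_3_1_of_abs {h : ℝ} {C : ℝ}
    (hC : ∀ θ T : ℝ, 2 ≤ T →
      |(stripZeroCount (diffXiArot |h| θ) T : ℝ) - lagariasZeroCountMain T| ≤ C * Real.log T ∧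
        |(stripZeroCount (diffXiBrot |h| θ) T : ℝ) - lagariasZeroCountMain T| ≤ C * Real.log T)
    (θ T : ℝ) (hT : 2 ≤ T) :
    |(stripZeroCount (diffXiArot h θ) T : ℝ) - lagariasZeroCountMain T| ≤ C * Real.log T ∧
      |(stripZeroCount (diffXiBrot h θ) T : ℝ) - lagariasZeroCountMain T| ≤ C * Real.log T := by
  rcases le_or_gt 0 h with h0 | h0
  · rw [abs_of_nonneg h0] at hC
    exact hC θ T hT
  · rw [abs_of_neg h0] at hC
    obtain ⟨hA, hB⟩ := hC (-θ) T hT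
    have eA : diffXiArot h θ = diffXiArot (-h) (-θ) := by rw [diffXiArot_neg, neg_neg]
    have eB : diffXiBrot h θ = -diffXiBrot (-h) (-θ) := by rw [diffXiBrot_neg, neg_neg, neg_neg]
    rw [eA, eB, stripZeroCount_neg]
    exact ⟨hA, hB⟩

/-- **Lagarias 2005, Theorem 3.1 (1)** — discharge of `lagarias2005_thm_3_1_1` (RH-FREE): for `|h| ≥ ½` there is
`C = C(h)` such that for every `0 ≤ θ < 2π` and `T ≥ 2`,
`|N(T, A_{h,θ}) − ((1/π) T log T − (1/π)(log 2π + 1) T)| ≤ C log T` and the same for `B_{h,θ}`.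
Inputs: Theorem 2.1 (1) (zeros on the line, simple), Lemma 2.1 (1) (`diffXiErot_critHB`), the phase velocity
`Re ξ'/ξ > 0` on `Re s ≥ 1` (`Lagarias1999Eq14.re_logDeriv_riemannXi_pos_of_one_le_re`), the zero-free half-plane
`Re s ≥ 1` (`riemannZeta_ne_zero_of_one_le_re`), and the phase asymptotics `exists_abs_xiPhase_sub_main_le`
(Stirling via the tree's `θ`, Backlund's `arg ζ = O(log T)`). [cite: Lagarias2005, Theorem 3.1 (1) (arXiv p. 9; held text p0007 L10)] -/
theorem lagarias2005_thm_3_1_1_holds : lagarias2005_thm_3_1_1 := by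
  intro h hh
  have hh' : 0 < |h| := by linarith
  obtain ⟨C, hC⟩ := stripZeroCount_diffXi_estimate hh' (fun θ ↦ diffXiErot_critHB hh θ)
    (fun t ↦ Lagarias1999Eq14.re_logDeriv_riemannXi_pos_of_one_le_re (by rw [re_half_add_mul_I_add]; linarith))
    (fun s hs ↦ riemannZeta_ne_zero_of_one_le_re (by linarith))
  exact ⟨C, fun θ T _ _ hT ↦ lagarias2005_thm_3_1_of_abs hC θ T hT⟩

/-- **Lagarias 2005, Theorem 3.1 (2)** — discharge of `lagarias2005_thm_3_1_2` (RH-CONSEQUENCE; the RH binder is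
the hypothesis of the discharged statement): under RH, for every `h ≠ 0` the same estimate with `C = C(h)`.
Inputs: Theorem 2.1 (2), Lemma 2.1 (2) (`diffXiErot_critHB_rh`), `RH ⟹ Re ξ'/ξ > 0` on `Re s > ½`
(`Lagarias1999_riemannHypothesis_iff_holds`), RH-zero-freeness (`riemannZeta_ne_zero_of_riemannHypothesis`), and
`exists_abs_xiPhase_sub_main_le`. [cite: Lagarias2005, Theorem 3.1 (2) (arXiv p. 9; held text p0007 L10)] -/
theorem lagarias2005_thm_3_1_2_holds : lagarias2005_thm_3_1_2 := by
  intro hRH h hh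
  have hh' : 0 < |h| := abs_pos.2 hh
  obtain ⟨C, hC⟩ := stripZeroCount_diffXi_estimate hh' (fun θ ↦ diffXiErot_critHB_rh hRH hh' θ)
    (fun t ↦ Lagarias1999_riemannHypothesis_iff_holds.1 hRH _ (by rw [re_half_add_mul_I_add]; linarith))
    (fun s hs ↦ riemannZeta_ne_zero_of_riemannHypothesis hRH (by linarith) (by linarith : 1 / 2 < s.re).ne')
  exact ⟨C, fun θ T _ _ hT ↦ lagarias2005_thm_3_1_of_abs hC θ T hT⟩

end Literature.NumberTheory.LFunctions
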